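import Literature.NumberTheory.PAdicHodge.KummerDepth
import Literature.NumberTheory.PAdicHodge.CyclotomicTowerPthPowers
import HarnessLib

/-!
# Tate's almost étale lemma for Kummer `p`-extensions: `Tr_{M(α)/M}(p^{-ε}𝓞) ∋ 1`
# (Tate 1967 §3.2 Prop. 9 / Berger–Colmez (TS1), degree-`p` step, PROVED for `M = K_∞`)

Let `E` be an ultrametric normed field with `0 < ‖p‖ < 1` and `M ⊆ E` a subfield carrying the
almost-perfectoid package ((Γ) `p`-divisible value group, (U_s) every integer is a `p`-th power modulo
`p^s`, `s > 0` — proved for `M = K_∞ = ℚ_p(μ_{p^∞}) ⊆ F̄` in `CyclotomicTowerPthPowers`). For every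
`a ∈ M` with `X^p - a` irreducible and any root `α ∈ E`:

* `TateAlmostEtale.exists_trace_eq_one_norm_le_of_kummer` : **for every `ε > 0` there is
  `y ∈ M(α)` with `Tr_{M(α)/M}(y) = 1` and `‖y‖ ≤ ‖p‖^{-ε}`** — i.e. `Tr_{M(α)/M}(𝓞_{M(α)})` contains
  elements of valuation `< ε`: Tate's almost étale lemma (`Tr(𝓞_L) ⊇ 𝔪`) for the cyclic degree-`p`
  extensions `L = M(α)` of `M`. Proof: renormalise the Kummer generator to depth `D = (1-ε) p/(p-1)`
  (`KummerDepth.exists_mul_pow_norm_sub_one_le`), then take the explicit trace-one element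
  `((a'-1)/(p a')) · α'/(α'-1)` of `KummerTraceOneElement`, of norm `≤ ‖p‖^{D(p-1)/p - 1} = ‖p‖^{-ε}`.
* `TateAlmostEtale.Kinf_exists_trace_eq_one_norm_le_of_kummer` : the case `M = K_∞ ⊆ F̄ = NormedAlgClosure F`
  (`F` a `p`-adic field): **a PROVED instance of the Tate–Sen axiom (TS1)** (`tate1967_TS1_completedAlgClosure`,
  cite-only in the tree) — the pairs `H₁ ≤ H₂ = H₀ = Gal(F̄/K_∞)` with `F̄^{H₁} = K_∞(a^{1/p})`.

What remains for the full (TS1) (all finite `L₁ ⊇ L₂ ⊇ K_∞`): propagation of the almost-perfectoid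
package along Kummer `p`-steps and prime-to-`p` steps, the Sylow-`p` dévissage (prime-to-`p` bottom:
`Tr(1/d) = 1`), and the Galois bridge `Σ_{s ∈ H₂/H₁} s • y = Tr_{L₁/L₂}(y)`. Own elementary route; the
statement served is Tate's. No `sorry`, no definitions.

References: J. Tate, *p-divisible groups* (1967) §3.2 Prop. 9 [Tate1967]; L. Berger, P. Colmez,
Astérisque 319 (2008), Déf. 3.1.3 (TS1), Prop. 4.1.1 [BergerColmez2008].
-/

noncomputable section

open Polynomial IntermediateField Module

namespace Literature.NumberTheory.PAdicHodge

namespace TateAlmostEtale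

section General

variable {E : Type*} [NormedField E] [IsUltrametricDist E] {K : Type*} [Field K] [Algebra K E]
  (M : IntermediateField K E) {p : ℕ}

omit [IsUltrametricDist E] in
/-- `M(α b) = M(α)` for `b ∈ M^×`. [folklore] -/
private theorem adjoin_mul_eq {α b : E} (hb : b ∈ M) (hb0 : b ≠ 0) :
    (↥M)⟮α * b⟯ = (↥M)⟮α⟯ := by
  have hbM : (b : E) ∈ (↥M)⟮α⟯ := by
    have := IntermediateField.algebraMap_mem (↥M)⟮α⟯ (⟨b, hb⟩ : M)
    exact this
  have hbM' : (b : E) ∈ (↥M)⟮α * b⟯ := by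
    have := IntermediateField.algebraMap_mem (↥M)⟮α * b⟯ (⟨b, hb⟩ : M)
    exact this
  apply le_antisymm
  · rw [adjoin_simple_le_iff]
    exact mul_mem (mem_adjoin_simple_self _ α) hbM
  · rw [adjoin_simple_le_iff]
    have hmem : α * b * b⁻¹ ∈ (↥M)⟮α * b⟯ :=
      mul_mem (mem_adjoin_simple_self _ (α * b)) (inv_mem hbM')
    rwa [mul_assoc, mul_inv_cancel₀ hb0, mul_one] at hmem

/-- **Tate's almost étale lemma for a Kummer `p`-extension of an almost-perfectoid field.** Let `M ⊆ E`
(`E` ultrametric, `0 < ‖p‖ < 1`, `p` prime) satisfy (Γ) and (U_s) with `s > 0`, let `a ∈ M` with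
`X^p - a` irreducible over `M` and `α ∈ E` a root. Then for every `ε > 0` there is `y ∈ M(α)` with
`Tr_{M(α)/M}(y) = 1` and `‖y‖ ≤ ‖p‖^{-ε}`: `1 ∈ Tr(p^{-ε} 𝓞_{M(α)})`, i.e. `Tr(𝓞_{M(α)}) ⊇ 𝔪_M`-type
surjectivity (Tate 1967 §3.2 Prop. 9 for the degree-`p` step).
[cite: Tate1967, §3.2 Prop. 9] [cite: BergerColmez2008, Prop. 4.1.1] -/
theorem exists_trace_eq_one_norm_le_of_kummer (hp : p.Prime) (hp0 : (p : E) ≠ 0)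
    (hp1 : ‖(p : E)‖ < 1) {s : ℝ} (hs : 0 < s)
    (hΓ : ∀ x ∈ M, x ≠ 0 → ∃ c ∈ M, ‖c‖ ^ p = ‖x‖)
    (hU : ∀ u ∈ M, ‖u‖ ≤ 1 → ∃ w ∈ M, ‖u - w ^ p‖ ≤ ‖(p : E)‖ ^ s)
    {a : M} (hirr : Irreducible (X ^ p - C a)) {α : E} (hα : α ^ p = (a : E))
    {ε : ℝ} (hε : 0 < ε) :
    ∃ y : (↥M)⟮α⟯, Algebra.trace M (↥M)⟮α⟯ y = 1 ∧ ‖(y : E)‖ ≤ ‖(p : E)‖ ^ (-ε) := by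
  set q : ℝ := ‖(p : E)‖ with hq
  have hq0 : 0 < q := norm_pos_iff.mpr hp0
  have hpr : (1 : ℝ) < p := by exact_mod_cast hp.one_lt
  -- WLOG `ε < 1`
  set ε' : ℝ := min ε (1 / 2) with hε'
  have hε'0 : 0 < ε' := lt_min hε one_half_pos
  have hε'1 : ε' < 1 := (min_le_right _ _).trans_lt one_half_lt_one
  have hε'ε : ε' ≤ ε := min_le_left _ _
  suffices h : ∃ y : (↥M)⟮α⟯, Algebra.trace M (↥M)⟮α⟯ y = 1 ∧ ‖(y : E)‖ ≤ q ^ (-ε') by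
    obtain ⟨y, hy, hyn⟩ := h
    exact ⟨y, hy, hyn.trans (Real.rpow_le_rpow_of_exponent_ge hq0 hp1.le (neg_le_neg hε'ε))⟩
  -- the depth `D = (1 - ε') p/(p-1)`
  set L : ℝ := (p : ℝ) / (p - 1) with hL
  have hL0 : 0 < L := div_pos (by linarith) (by linarith)
  set D : ℝ := (1 - ε') * L with hD
  have hD0 : 0 < D := mul_pos (by linarith) hL0
  have hDL : D < L := by
    rw [hD]; nlinarith
  have hpne : (p : ℝ) ≠ 0 := by positivity
  have hp1ne : (p : ℝ) - 1 ≠ 0 := by linarith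
  have hDexp : D * ((p : ℝ) - 1) / p - 1 = -ε' := by
    rw [hD, hL]; field_simp; ring
  -- `a ≠ 0`, renormalise `a` by a `p`-th power to depth `D`
  have ha0 : a ≠ 0 := ne_zero_of_irreducible_X_pow_sub_C' hp.one_lt.ne' hirr
  have ha0E : (a : E) ≠ 0 := by
    intro h; apply ha0; exact_mod_cast h
  obtain ⟨b, hbM, hb0, hb⟩ := exists_mul_pow_norm_sub_one_le M.toSubfield hp hp0 hp1 hs
    (fun x hx hx0 => hΓ x hx hx0) (fun u hu hu1 => hU u hu hu1) a.2 ha0E hDL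
  set b' : M := ⟨b, hbM⟩ with hb'
  set a' : M := a * b' ^ p with ha'
  have ha'E : (a' : E) = (a : E) * b ^ p := by rw [ha']; push_cast; rw [hb']
  have hb'0 : b' ≠ 0 := by
    intro h; apply hb0
    have := congrArg Subtype.val h
    simpa [hb'] using this
  -- `X^p - a'` is irreducible, so `a' ≠ 0, 1`
  have hirr' : Irreducible (X ^ p - C a') := by
    rw [X_pow_sub_C_irreducible_iff_of_prime hp] at hirr ⊢
    intro z hz
    apply hirr (z / b')
    rw [div_pow, hz, ha', mul_div_cancel_right₀ _ (pow_ne_zero _ hb'0)]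
  have ha'1 : a' ≠ 1 := by
    intro h
    rw [X_pow_sub_C_irreducible_iff_of_prime hp] at hirr'
    exact hirr' 1 (by rw [one_pow, h])
  have ha'0 : a' ≠ 0 := ne_zero_of_irreducible_X_pow_sub_C' hp.one_lt.ne' hirr'
  -- norms: `‖a' - 1‖ ≤ q^D < 1`, so `‖a'‖ = 1 = ‖α b‖`
  have hdepth : ‖(a' : E) - 1‖ ≤ q ^ D := by rw [ha'E]; exact hb
  have ha'n : ‖(a' : E)‖ = 1 := by
    have hlt : ‖(a' : E) - 1‖ < 1 := hdepth.trans_lt (Real.rpow_lt_one hq0.le hp1 hD0)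
    have : (a' : E) = 1 + ((a' : E) - 1) := by ring
    rw [this]
    have h := IsUltrametricDist.norm_add_eq_max_of_norm_ne_norm (x := (1 : E)) (y := (a' : E) - 1)
      (by rw [norm_one]; exact hlt.ne')
    rw [h, norm_one, max_eq_left hlt.le]
  set α' : E := α * b with hα'
  have hα'p : α' ^ p = (a' : E) := by rw [hα', mul_pow, hα, ha'E]
  have hα'n : ‖α'‖ = 1 := by
    have : ‖α'‖ ^ p = 1 := by rw [← norm_pow, hα'p, ha'n]
    exact (pow_eq_one_iff_of_nonneg (norm_nonneg _) hp.ne_zero).mp this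
  have ha'1E : (a' : E) ≠ 1 := by
    intro h; apply ha'1; exact_mod_cast h
  -- the field `M(α)` and its generator `γ = α b`
  have hint : IsIntegral M α := ⟨X ^ p - C a, monic_X_pow_sub_C a hp.ne_zero, by simp [hα]⟩
  haveI : FiniteDimensional M (↥M)⟮α⟯ := adjoin.finiteDimensional hint
  have hminpoly : minpoly M α = X ^ p - C a :=
    (minpoly.eq_of_irreducible_of_monic hirr (by simp [hα]) (monic_X_pow_sub_C a hp.ne_zero)).symm
  have hfin : finrank M (↥M)⟮α⟯ = p := by
    rw [adjoin.finrank hint, hminpoly, natDegree_X_pow_sub_C]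
  have hγmem : α' ∈ (↥M)⟮α⟯ := by
    rw [hα']
    exact mul_mem (mem_adjoin_simple_self _ α) (IntermediateField.algebraMap_mem (↥M)⟮α⟯ b')
  set γ : (↥M)⟮α⟯ := ⟨α', hγmem⟩ with hγ
  have hγp : γ ^ p = algebraMap M (↥M)⟮α⟯ a' := by
    apply Subtype.ext
    change (γ : E) ^ p = ((algebraMap M (↥M)⟮α⟯ a' : (↥M)⟮α⟯) : E)
    rw [IntermediateField.coe_algebraMap_apply]
    exact hα'p
  have hgen : (↥M)⟮γ⟯ = ⊤ := by
    apply IntermediateField.lift_injective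
    rw [lift_adjoin_simple, lift_top]
    change (↥M)⟮α * b⟯ = (↥M)⟮α⟯
    exact adjoin_mul_eq M hbM hb0
  have hpM : (p : M) ≠ 0 := by
    intro h; apply hp0
    have := congrArg (fun z : M => (z : E)) h
    simpa using this
  -- the explicit trace-one element
  set y : (↥M)⟮α⟯ := ((a' - 1) * (p * a')⁻¹) • (γ * (γ - 1)⁻¹) with hy
  refine ⟨y, KummerTrace.trace_traceOneElt hp.pos hpM hγp ha'1 ha'0 hgen hfin, ?_⟩
  -- its norm
  have hyE : (y : E) = (((a' : E) - 1) * ((p : E) * (a' : E))⁻¹) * (α' * (α' - 1)⁻¹) := by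
    rw [hy, IntermediateField.coe_smul, Algebra.smul_def]
    push_cast
    rw [hγ]
    rfl
  rw [hyE]
  refine (KummerTrace.norm_traceOneElt_le_rpow hp hp0 hα'p hα'n ha'n ha'1E hdepth).trans ?_
  rw [hDexp, max_eq_right]
  exact Real.one_le_rpow_of_pos_of_le_one_of_nonpos hq0 hp1.le (neg_nonpos.mpr hε'0.le)

end General

/-! ### The proved instance: `M = K_∞ = K₀(μ_{p^∞}) ⊆ F̄` -/

section Kinf

open ValuativeRel Field CyclotomicTower TateTrace
open Literature.NumberTheory.GaloisRepresentations
open Literature.NumberTheory.GaloisRepresentations.IsNonarchimedeanLocalField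

variable {F : Type} [Field F] [ValuativeRel F] [TopologicalSpace F] [IsNonarchimedeanLocalField F]
  [CharZero F] {p : ℕ} [Fact p.Prime] (hp : valuation F p < 1)

/-- **Tate's almost étale lemma for the Kummer `p`-extensions of `K_∞` — PROVED.** For a `p`-adic field
`F`, `K_∞ = K₀(μ_{p^∞}) ⊆ F̄` (`TateTrace.Kinf`), every `a ∈ K_∞` with `X^p - a` irreducible, any root
`α ∈ F̄` and every `ε > 0`: there is `y ∈ K_∞(α)` with `Tr_{K_∞(α)/K_∞}(y) = 1` and `‖y‖ ≤ ‖p‖^{-ε}`.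
This is the Tate–Sen condition (TS1) (`tate1967_TS1_completedAlgClosure`, cite-only) for the pairs
`H₁ ≤ H₂ = H₀` with `F̄^{H₁} = K_∞(a^{1/p})`, obtained from the almost-perfectoid package of `K_∞`
(`Kinf_exists_norm_pow_eq`, `Kinf_exists_norm_sub_pow_le`), Kummer depth, and the explicit trace-one
element. [cite: Tate1967, §3.2 Prop. 9] [cite: BergerColmez2008, Prop. 4.1.1] -/
theorem Kinf_exists_trace_eq_one_norm_le_of_kummer {a : Kinf hp}
    (hirr : Irreducible (Polynomial.X ^ p - C a))
    {α : NormedAlgClosure F} (hα : α ^ p = (a : NormedAlgClosure F)) {ε : ℝ} (hε : 0 < ε) :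
    ∃ y : (↥(Kinf hp))⟮α⟯, Algebra.trace (Kinf hp) (↥(Kinf hp))⟮α⟯ y = 1 ∧
      ‖(y : NormedAlgClosure F)‖ ≤ ‖(p : NormedAlgClosure F)‖ ^ (-ε) := by
  have hprime : p.Prime := Fact.out
  have hp0 : (p : NormedAlgClosure F) ≠ 0 := Nat.cast_ne_zero.mpr hprime.ne_zero
  have hp1 : ‖(p : NormedAlgClosure F)‖ < 1 := by
    rw [PadicBase.norm_natCast_closure hp]; exact PadicBase.norm_p_lt_one hp
  refine exists_trace_eq_one_norm_le_of_kummer (Kinf hp) hprime hp0 hp1 one_pos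
    (fun x hx hx0 => Kinf_exists_norm_pow_eq hp hx hx0) (fun u hu hu1 => ?_) hirr hα hε
  rw [Real.rpow_one]
  exact Kinf_exists_norm_sub_pow_le hp hu hu1

end Kinf

end TateAlmostEtale

end Literature.NumberTheory.PAdicHodge

end
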